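import Summits.Ventures.CertifiedManyBodySolver.Rows.DopedTLCorrFilling
import Literature.MathematicalPhysics.QuantumLattice.HubbardNNNHoppingTorusLimitCorrelatorAffine
import HarnessLib

/-!
# The AFFINE claim-node shapes are KERNEL-GROUNDED for multipliers of EITHER sign: a `t–t'` window certificate IS
# `SquareTTPrimeCorrAffineOrbitLowerRow` / `…AffineLowerRow` / `…AffineOrbitLowerRowN` — the instantiation schemas

HONEST FRAMING: soundness edge only (Lean plumbing between a certificate identity and the cell's row predicates); no number,
no claim node, nothing discharged, no claim on any ground state; CONTROL/CALIBRATION stiffness-scale CEILINGS (wording (xx1))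
are what the rows are used for, and a ceiling never speaks to the presence of superconductivity; not a `T_c` or phase sentence;
no summit statement is proved by this file. Seat hubbard-obs-p2 (STIFFNESS), `prover-hubbard-obs-p2-g22-0`, zero compute.

Companion of `Rows/DopedTLCorrAffine.lean` (hubbard-obs-p2 g7: the affine predicates, «what a window certificate proves BEFORE
the energy window is inserted», there justified in prose) and of `Rows/DopedTLCorrFillingCert.lean` (hubbard-downfold-unc-2 g12:
the affine-N row from a certificate with `κhi, κlo ≥ 0`, by re-booking both energy rows to the unknown energy and calling the
capped Literature theorem with the trivial window `e₀ ≤ e₀ ≤ e₀`). The Literature now has the affine edge ITSELF —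
`InfVolFermionState.IsTorusLimitOf.re_sum_expect_d4_ge_of_window_certificate_TT'_affine₂`
(`Literature/…/HubbardNNNHoppingTorusLimitCorrelatorAffine.lean`, p658585): the window identity with cap multiplier `κhi` and
floor multiplier `κlo` of EITHER sign and NO energy hypothesis gives, for every torus limit of unit sector ground states,
`c − Σ‖aₖ‖ + (Σμ)(n/2 − ν) + κhi (hi − e₀) + κlo (e₀ − lo) ≤ orbit mean`. This file is the matching set of INSTANTIATION
SCHEMAS (binder lists verbatim those of the Literature theorem at `t = 1`, so a kernel-checked certificate — tier P — or a
producer reading one becomes a node-shaped theorem by ONE `exact`):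

* `SquareTTPrimeCorrAffineOrbitLowerRow.of_window_certificate` — the `D₄`-orbit affine row at the density `n` the state class
  names (`0 ≤ n < 2`), slot `q ≤ c − Σ‖aₖ‖ + (Σμ)(n/2 − ν)`; no sign on `κhi, κlo`;
* `SquareTTPrimeCorrAffineLowerRow.of_window_certificate` — translation-only certificates (`γₗ = 1`), plain row;
* `SquareTTPrimeCorrAffineOrbitLowerRowN.of_window_certificate'` — the density-parametrised affine-N row (slope
  `s = ½ Σ_σ μ_σ`) WITHOUT the sign hypotheses of unc-2's `…N.of_window_certificate`.

References: J. Wang et al., PRX 14 (2024) 031006, §III [WangEtAl2024]; S. Boyd, L. Vandenberghe, *Convex Optimization* (2004)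
§5.6 (the optimal value is affine-bounded in the constraint level with slope the multiplier, either sign) [BoydVandenberghe2004].
-/

noncomputable section

namespace Summit.Ventures.CertifiedManyBodySolver

open Literature.MathematicalPhysics.QuantumLattice
open Literature.MathematicalPhysics.QuantumManyBody.StateRelaxation
open Matrix Finset HubbardWave0 Literature.Probability.LatticeModels ThermodynamicLimit Filter Topology
open scoped ComplexOrder BigOperators

/-- **Window certificate (two energy rows, multipliers of either sign) ⇒ the AFFINE `D₄`-orbit row at density `n`.**
Data: the binder list of `IsTorusLimitOf.re_sum_expect_d4_ge_of_window_certificate_TT'_affine₂` at `t = 1`, NNN hopping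
`tp`, coupling `U ≥ 0`, density `0 ≤ n < 2`, rational slots `κhi, hi, κlo, lo` (NO sign hypothesis) and `q` with
`q ≤ c − Σₖ‖aₖ‖ + (Σ_σ μ_σ)(n/2 − ν)`. Conclusion: `SquareTTPrimeCorrAffineOrbitLowerRow tp U n q hi lo κhi κlo S Λ' Xw` —
`q + κhi·(hi − e₀) + κlo·(e₀ − lo) ≤ |S|⁻¹ Σ_γ Re ω_{γΛ'}(Γ(d4Emb γ 0) Xw)` for every torus-limit ground state, no energy
hypothesis. [cite: WangEtAl2024, §III] [cite: BoydVandenberghe2004, §5.6] -/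
theorem SquareTTPrimeCorrAffineOrbitLowerRow.of_window_certificate
    (tp : ℝ) {U : ℝ} (hU : 0 ≤ U) {n : ℝ} (hn0 : 0 ≤ n) (hn2 : n < 2) (κhi hi κlo lo : ℚ)
    {Λ Λ' : Finset (Site 2)} (hΛ : Λ ⊆ Λ') (h8 : thicken Λ 1 ⊆ Λ')
    (h0 : thicken ({0} : Finset (Site 2)) 1 ⊆ Λ') (hz : (0 : Site 2) ∈ Λ')
    {S : Finset (DihedralGroup 4)} (h1 : (1 : DihedralGroup 4) ∈ S) (hmul : ∀ a ∈ S, ∀ b ∈ S, a * b ∈ S)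
    (Xw : FermionOp Λ') (μ : Fin 2 → ℝ) (ν : ℝ)
    {m : Type*} [Fintype m] [DecidableEq m] {Λm : Matrix m m ℂ} (hΛm : Λm.PosSemidef)
    (O : m → FermionOp Λ')
    {κ' : Type*} (sB : Finset κ') (B : κ' → FermionOp Λ)
    {ι : Type*} (tt : Finset ι) (γ : ι → DihedralGroup 4) (hγS : ∀ l ∈ tt, γ l ∈ S) (wv : ι → Site 2)
    (hsh : ∀ l, d4ShiftSet (γ l) (wv l) Λ ⊆ Λ') (Y : ι → FermionOp Λ)
    {ρ : Type*} (uu : Finset ρ) (b : ρ → ℂ) (cw : ρ → List (Orb (PolySite Λ') × Bool))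
    (hcw : ∀ j ∈ uu, ladderCharge (cw j) ≠ 0 ∨ ladderSpinCharge (cw j) ≠ 0)
    {δ : Type*} (ah : Finset δ) (dc : δ → ℝ) (V : δ → FermionOp Λ')
    {κ'' : Type*} (w : Finset κ'') (a : κ'' → ℂ) (word : κ'' → List (Orb (PolySite Λ') × Bool)) {c : ℝ}
    (hcert : Xw - (c : ℂ) • (1 : FermionOp Λ') -
        ∑ σ : Fin 2, ((μ σ : ℝ) : ℂ) • (nAt 0 hz σ - ((ν : ℝ) : ℂ) • (1 : FermionOp Λ')) -
        ((((κhi : ℚ) : ℝ) : ℝ) : ℂ) • (((((hi : ℚ) : ℝ) : ℝ) : ℂ) • (1 : FermionOp Λ') -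
          fermionEmbed (PolySite.incl h0) ((hubbardTTPrimeFermionInteraction 1 tp U).meanEnergyObs 1)) -
        ((((κlo : ℚ) : ℝ) : ℝ) : ℂ) • (fermionEmbed (PolySite.incl h0) ((hubbardTTPrimeFermionInteraction 1 tp U).meanEnergyObs 1) -
          ((((lo : ℚ) : ℝ) : ℝ) : ℂ) • (1 : FermionOp Λ')) =
      gramForm Λm O +
        (∑ k ∈ sB, ((hubbardTTPrimeFermionInteraction 1 tp U).localHamiltonian Λ' * fermionEmbed (PolySite.incl hΛ) (B k) -
            fermionEmbed (PolySite.incl hΛ) (B k) * (hubbardTTPrimeFermionInteraction 1 tp U).localHamiltonian Λ') +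
          ∑ l ∈ tt, (fermionEmbed (PolySite.incl (hsh l)) (fermionEmbed (PolySite.d4Emb (γ l) (wv l) Λ) (Y l)) -
            fermionEmbed (PolySite.incl hΛ) (Y l)) +
          ∑ j ∈ uu, b j • ladderWord (cw j)) +
        (∑ m' ∈ ah, ((dc m' : ℝ) : ℂ) • ((V m')ᴴ - V m') + ∑ k ∈ w, a k • ladderWord (word k)))
    {q : ℚ} (hq : ((q : ℚ) : ℝ) ≤ c - ∑ k ∈ w, ‖a k‖ + (∑ σ : Fin 2, μ σ) * (n / 2 - ν)) :
    SquareTTPrimeCorrAffineOrbitLowerRow tp U n q hi lo κhi κlo S Λ' Xw := by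
  intro ω Ls ψ hLs hψ hψ1 hω
  have hmain := hω.re_sum_expect_d4_ge_of_window_certificate_TT'_affine₂ 1 tp hU hn0 hn2 ((κhi : ℚ) : ℝ)
    ((hi : ℚ) : ℝ) ((κlo : ℚ) : ℝ) ((lo : ℚ) : ℝ) hΛ h8 h0 hz h1 hmul Xw μ ν hΛm O sB B tt γ hγS wv hsh Y uu b cw
    hcw ah dc V w a word hcert hLs hψ hψ1
  linarith

/-- **Translation-only window certificate (two energy rows, either sign) ⇒ the plain AFFINE row at density `n`**
(all point-group labels `γₗ = 1`): `SquareTTPrimeCorrAffineLowerRow tp U n q hi lo κhi κlo Λ' Xw`, i.e.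
`q + κhi·(hi − e₀) + κlo·(e₀ − lo) ≤ Re ω_{Λ'}(Xw)` for every torus-limit ground state. [cite: WangEtAl2024, §III] -/
theorem SquareTTPrimeCorrAffineLowerRow.of_window_certificate
    (tp : ℝ) {U : ℝ} (hU : 0 ≤ U) {n : ℝ} (hn0 : 0 ≤ n) (hn2 : n < 2) (κhi hi κlo lo : ℚ)
    {Λ Λ' : Finset (Site 2)} (hΛ : Λ ⊆ Λ') (h8 : thicken Λ 1 ⊆ Λ')
    (h0 : thicken ({0} : Finset (Site 2)) 1 ⊆ Λ') (hz : (0 : Site 2) ∈ Λ')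
    (Xw : FermionOp Λ') (μ : Fin 2 → ℝ) (ν : ℝ)
    {m : Type*} [Fintype m] [DecidableEq m] {Λm : Matrix m m ℂ} (hΛm : Λm.PosSemidef)
    (O : m → FermionOp Λ')
    {κ' : Type*} (sB : Finset κ') (B : κ' → FermionOp Λ)
    {ι : Type*} (tt : Finset ι) (γ : ι → DihedralGroup 4) (hγ1 : ∀ l ∈ tt, γ l = 1) (wv : ι → Site 2)
    (hsh : ∀ l, d4ShiftSet (γ l) (wv l) Λ ⊆ Λ') (Y : ι → FermionOp Λ)
    {ρ : Type*} (uu : Finset ρ) (b : ρ → ℂ) (cw : ρ → List (Orb (PolySite Λ') × Bool))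
    (hcw : ∀ j ∈ uu, ladderCharge (cw j) ≠ 0 ∨ ladderSpinCharge (cw j) ≠ 0)
    {δ : Type*} (ah : Finset δ) (dc : δ → ℝ) (V : δ → FermionOp Λ')
    {κ'' : Type*} (w : Finset κ'') (a : κ'' → ℂ) (word : κ'' → List (Orb (PolySite Λ') × Bool)) {c : ℝ}
    (hcert : Xw - (c : ℂ) • (1 : FermionOp Λ') -
        ∑ σ : Fin 2, ((μ σ : ℝ) : ℂ) • (nAt 0 hz σ - ((ν : ℝ) : ℂ) • (1 : FermionOp Λ')) -
        ((((κhi : ℚ) : ℝ) : ℝ) : ℂ) • (((((hi : ℚ) : ℝ) : ℝ) : ℂ) • (1 : FermionOp Λ') -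
          fermionEmbed (PolySite.incl h0) ((hubbardTTPrimeFermionInteraction 1 tp U).meanEnergyObs 1)) -
        ((((κlo : ℚ) : ℝ) : ℝ) : ℂ) • (fermionEmbed (PolySite.incl h0) ((hubbardTTPrimeFermionInteraction 1 tp U).meanEnergyObs 1) -
          ((((lo : ℚ) : ℝ) : ℝ) : ℂ) • (1 : FermionOp Λ')) =
      gramForm Λm O +
        (∑ k ∈ sB, ((hubbardTTPrimeFermionInteraction 1 tp U).localHamiltonian Λ' * fermionEmbed (PolySite.incl hΛ) (B k) -
            fermionEmbed (PolySite.incl hΛ) (B k) * (hubbardTTPrimeFermionInteraction 1 tp U).localHamiltonian Λ') +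
          ∑ l ∈ tt, (fermionEmbed (PolySite.incl (hsh l)) (fermionEmbed (PolySite.d4Emb (γ l) (wv l) Λ) (Y l)) -
            fermionEmbed (PolySite.incl hΛ) (Y l)) +
          ∑ j ∈ uu, b j • ladderWord (cw j)) +
        (∑ m' ∈ ah, ((dc m' : ℝ) : ℂ) • ((V m')ᴴ - V m') + ∑ k ∈ w, a k • ladderWord (word k)))
    {q : ℚ} (hq : ((q : ℚ) : ℝ) ≤ c - ∑ k ∈ w, ‖a k‖ + (∑ σ : Fin 2, μ σ) * (n / 2 - ν)) :
    SquareTTPrimeCorrAffineLowerRow tp U n q hi lo κhi κlo Λ' Xw := by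
  intro ω Ls ψ hLs hψ hψ1 hω
  have hmain := hω.re_expect_ge_of_window_certificate_TT'_affine₂ 1 tp hU hn0 hn2 ((κhi : ℚ) : ℝ)
    ((hi : ℚ) : ℝ) ((κlo : ℚ) : ℝ) ((lo : ℚ) : ℝ) hΛ h8 h0 hz Xw μ ν hΛm O sB B tt γ hγ1 wv hsh Y uu b cw
    hcw ah dc V w a word hcert hLs hψ hψ1
  linarith

/-- **Window certificate (two energy rows, either sign) ⇒ the density-parametrised AFFINE-N row** (slope
`s = ½ Σ_σ μ_σ`, reference density `n₀`, slot `q ≤ c − Σₖ‖aₖ‖ + (Σ_σ μ_σ)(n₀/2 − ν)`):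
`SquareTTPrimeCorrAffineOrbitLowerRowN tp U q hi lo κhi κlo s n₀ S Λ' Xw` — the identity is density-free, so the affine
Literature edge is applied AT EACH density `x ∈ [0, 2)` of the predicate's binder. Same conclusion as unc-2's
`SquareTTPrimeCorrAffineOrbitLowerRowN.of_window_certificate` WITHOUT its hypotheses `0 ≤ κhi`, `0 ≤ κlo`.
[cite: WangEtAl2024, §III] [cite: BoydVandenberghe2004, §5.6] -/
theorem SquareTTPrimeCorrAffineOrbitLowerRowN.of_window_certificate'
    (tp : ℝ) {U : ℝ} (hU : 0 ≤ U) (κhi hi κlo lo : ℚ)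
    {Λ Λ' : Finset (Site 2)} (hΛ : Λ ⊆ Λ') (h8 : thicken Λ 1 ⊆ Λ')
    (h0 : thicken ({0} : Finset (Site 2)) 1 ⊆ Λ') (hz : (0 : Site 2) ∈ Λ')
    {S : Finset (DihedralGroup 4)} (h1 : (1 : DihedralGroup 4) ∈ S) (hmul : ∀ a ∈ S, ∀ b ∈ S, a * b ∈ S)
    (Xw : FermionOp Λ') (μ : Fin 2 → ℝ) (ν : ℝ)
    {m : Type*} [Fintype m] [DecidableEq m] {Λm : Matrix m m ℂ} (hΛm : Λm.PosSemidef)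
    (O : m → FermionOp Λ')
    {κ' : Type*} (sB : Finset κ') (B : κ' → FermionOp Λ)
    {ι : Type*} (tt : Finset ι) (γ : ι → DihedralGroup 4) (hγS : ∀ l ∈ tt, γ l ∈ S) (wv : ι → Site 2)
    (hsh : ∀ l, d4ShiftSet (γ l) (wv l) Λ ⊆ Λ') (Y : ι → FermionOp Λ)
    {ρ : Type*} (uu : Finset ρ) (b : ρ → ℂ) (cw : ρ → List (Orb (PolySite Λ') × Bool))
    (hcw : ∀ j ∈ uu, ladderCharge (cw j) ≠ 0 ∨ ladderSpinCharge (cw j) ≠ 0)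
    {δ : Type*} (ah : Finset δ) (dc : δ → ℝ) (V : δ → FermionOp Λ')
    {κ'' : Type*} (w : Finset κ'') (a : κ'' → ℂ) (word : κ'' → List (Orb (PolySite Λ') × Bool)) {c : ℝ}
    (hcert : Xw - (c : ℂ) • (1 : FermionOp Λ') -
        ∑ σ : Fin 2, ((μ σ : ℝ) : ℂ) • (nAt 0 hz σ - ((ν : ℝ) : ℂ) • (1 : FermionOp Λ')) -
        ((((κhi : ℚ) : ℝ) : ℝ) : ℂ) • (((((hi : ℚ) : ℝ) : ℝ) : ℂ) • (1 : FermionOp Λ') -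
          fermionEmbed (PolySite.incl h0) ((hubbardTTPrimeFermionInteraction 1 tp U).meanEnergyObs 1)) -
        ((((κlo : ℚ) : ℝ) : ℝ) : ℂ) • (fermionEmbed (PolySite.incl h0) ((hubbardTTPrimeFermionInteraction 1 tp U).meanEnergyObs 1) -
          ((((lo : ℚ) : ℝ) : ℝ) : ℂ) • (1 : FermionOp Λ')) =
      gramForm Λm O +
        (∑ k ∈ sB, ((hubbardTTPrimeFermionInteraction 1 tp U).localHamiltonian Λ' * fermionEmbed (PolySite.incl hΛ) (B k) -
            fermionEmbed (PolySite.incl hΛ) (B k) * (hubbardTTPrimeFermionInteraction 1 tp U).localHamiltonian Λ') +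
          ∑ l ∈ tt, (fermionEmbed (PolySite.incl (hsh l)) (fermionEmbed (PolySite.d4Emb (γ l) (wv l) Λ) (Y l)) -
            fermionEmbed (PolySite.incl hΛ) (Y l)) +
          ∑ j ∈ uu, b j • ladderWord (cw j)) +
        (∑ m' ∈ ah, ((dc m' : ℝ) : ℂ) • ((V m')ᴴ - V m') + ∑ k ∈ w, a k • ladderWord (word k)))
    {q s n₀ : ℚ} (hs : ((s : ℚ) : ℝ) = (∑ σ : Fin 2, μ σ) / 2)
    (hq : ((q : ℚ) : ℝ) ≤ c - ∑ k ∈ w, ‖a k‖ + (∑ σ : Fin 2, μ σ) * (((n₀ : ℚ) : ℝ) / 2 - ν)) :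
    SquareTTPrimeCorrAffineOrbitLowerRowN tp U q hi lo κhi κlo s n₀ S Λ' Xw := by
  intro x hx0 hx2 ω Ls ψ hLs hψ hψ1 hω
  have hmain := hω.re_sum_expect_d4_ge_of_window_certificate_TT'_affine₂ 1 tp hU hx0 hx2 ((κhi : ℚ) : ℝ)
    ((hi : ℚ) : ℝ) ((κlo : ℚ) : ℝ) ((lo : ℚ) : ℝ) hΛ h8 h0 hz h1 hmul Xw μ ν hΛm O sB B tt γ hγS wv hsh Y uu b cw
    hcw ah dc V w a word hcert hLs hψ hψ1
  have hval : ((q : ℚ) : ℝ) + ((s : ℚ) : ℝ) * (x - ((n₀ : ℚ) : ℝ)) ≤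
      c - ∑ k ∈ w, ‖a k‖ + (∑ σ : Fin 2, μ σ) * (x / 2 - ν) := by
    rw [hs]
    have : (∑ σ : Fin 2, μ σ) * (x / 2 - ν) =
        (∑ σ : Fin 2, μ σ) * (((n₀ : ℚ) : ℝ) / 2 - ν) + (∑ σ : Fin 2, μ σ) / 2 * (x - ((n₀ : ℚ) : ℝ)) := by ring
    rw [this]
    linarith
  linarith

end Summit.Ventures.CertifiedManyBodySolver

end
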